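import Mathlib.Algebra.Order.Field.Basic
import Mathlib.Algebra.Order.BigOperators.Ring.Finset
import Mathlib.Algebra.BigOperators.Ring.Finset
import Mathlib.Algebra.Order.AbsoluteValue.Basic
import Mathlib.Analysis.SpecialFunctions.Pow.Real
import Mathlib.Tactic.Linarith
import Mathlib.Tactic.FieldSimp
import Mathlib.Tactic.Positivity
import Mathlib.Tactic.Ring
import HarnessLib

/-!
# Higham's `γ_n` and Lemma 3.1 (accumulation of relative errors)

HONEST FRAMING (venture CertifiedArithmetic / cell `pub-lowprec`): certified error envelopes and
provably optimal rounding/accumulation schemes for low-precision formats under stated cost models;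
every table by two implementations; no hardware or vendor claims.

Typed and PROVED from [Higham2002ASNA, §3.1 and Lemma 3.1]: with unit roundoff `u` and `nu < 1`,
`γ_n := nu / (1 - nu)`, and if `|δ_i| ≤ u`, `ρ_i = ±1` (`i = 1..n`) then
`∏ (1 + δ_i)^{ρ_i} = 1 + θ_n` with `|θ_n| ≤ γ_n`. We prove the slightly more general product form
(`abs_prod_sub_one_le_gamma`: factors in `[1 - u, (1 - u)⁻¹]`), from the two elementary inequalities
`(1 - u)^n ≥ 1 - nu` (Bernoulli) and hence `(1 - u)^{-n} ≤ (1 - nu)⁻¹ = 1 + γ_n`, then derive the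
`δ/ρ` form (`exists_theta_prod_eq`). Also `(1 + u)^n - 1 ≤ γ_n` (`one_add_pow_sub_one_le_gamma`),
the form used for recursive summation (file `Summation.lean`). Everything is over an arbitrary
linearly ordered field (`ℚ` for the cell's exact tables, `ℝ` for the textbook statement).
-/

namespace Literature.ComputerArithmetic.Higham2002

open Finset

variable {K : Type*} [Field K] [LinearOrder K] [IsStrictOrderedRing K]

/-- Higham's constant `γ_n = nu / (1 - nu)` (meaningful when `nu < 1`).
[cite: Higham2002ASNA, Lemma 3.1] -/
def gamma (u : K) (n : ℕ) : K := n * u / (1 - n * u)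

/-- `γ_n ≥ 0` for `u ≥ 0`, `nu < 1`. [cite: Higham2002ASNA, Lemma 3.1] -/
theorem gamma_nonneg {u : K} (hu : 0 ≤ u) {n : ℕ} (hn : (n : K) * u < 1) : 0 ≤ gamma u n := by
  unfold gamma
  exact div_nonneg (by positivity) (by linarith)

/-- `nu ≤ γ_n` for `u ≥ 0`, `nu < 1`. [cite: Higham2002ASNA, Lemma 3.1] -/
theorem mul_le_gamma {u : K} (hu : 0 ≤ u) {n : ℕ} (hn : (n : K) * u < 1) : (n : K) * u ≤ gamma u n := by
  unfold gamma
  rw [le_div_iff₀ (by linarith)]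
  nlinarith [mul_nonneg (Nat.cast_nonneg n) hu]

/-- `1 + γ_n = (1 - nu)⁻¹`. [cite: Higham2002ASNA, Lemma 3.1] -/
theorem one_add_gamma {u : K} {n : ℕ} (hn : (n : K) * u < 1) :
    1 + gamma u n = (1 - (n : K) * u)⁻¹ := by
  unfold gamma
  have : (1 - (n : K) * u) ≠ 0 := by linarith
  field_simp
  ring

/-- Bernoulli: `1 - nu ≤ (1 - u)^n` for `u ≤ 1`. [cite: Higham2002ASNA, Lemma 3.1] -/
theorem one_sub_mul_le_one_sub_pow {u : K} (hu1 : u ≤ 1) (n : ℕ) :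
    1 - (n : K) * u ≤ (1 - u) ^ n := by
  have h := one_add_mul_le_pow (a := -u) (by linarith) n
  have e1 : (1 : K) + (n : K) * -u = 1 - (n : K) * u := by ring
  have e2 : (1 : K) + -u = 1 - u := by ring
  rw [e1, e2] at h
  exact h

/-- `(1 + u)^n · (1 - nu) ≤ 1` for `u ≥ 0` (so `(1 + u)^n ≤ 1 + γ_n` when `nu < 1`).
[cite: Higham2002ASNA, Lemma 3.1] -/
theorem one_add_pow_mul_one_sub_le {u : K} (hu : 0 ≤ u) :
    ∀ n : ℕ, (1 + u) ^ n * (1 - (n : K) * u) ≤ 1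
  | 0 => by simp
  | n + 1 => by
      have ih := one_add_pow_mul_one_sub_le hu n
      have hp : 0 ≤ (1 + u) ^ n := by positivity
      push_cast
      calc (1 + u) ^ (n + 1) * (1 - ((n : K) + 1) * u)
          = (1 + u) ^ n * (1 - (n : K) * u) - (1 + u) ^ n * (((n : K) + 1) * u * u) := by ring
        _ ≤ 1 - 0 := by
            apply sub_le_sub ih
            positivity
        _ = 1 := by ring

/-- `(1 + u)^n - 1 ≤ γ_n` for `u ≥ 0`, `nu < 1`. [cite: Higham2002ASNA, Lemma 3.1] -/
theorem one_add_pow_sub_one_le_gamma {u : K} (hu : 0 ≤ u) {n : ℕ} (hn : (n : K) * u < 1) :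
    (1 + u) ^ n - 1 ≤ gamma u n := by
  have h := one_add_pow_mul_one_sub_le hu n
  have hpos : 0 < 1 - (n : K) * u := by linarith
  have : (1 + u) ^ n ≤ (1 - (n : K) * u)⁻¹ := by
    rw [inv_eq_one_div, le_div_iff₀ hpos]; exact h
  linarith [one_add_gamma (u := u) hn]

/-- `(1 - u)^{-n} - 1 ≤ γ_n` for `u < 1`, `nu < 1`. [cite: Higham2002ASNA, Lemma 3.1] -/
theorem inv_one_sub_pow_sub_one_le_gamma {u : K} (hu1 : u < 1) {n : ℕ}
    (hn : (n : K) * u < 1) : ((1 - u) ^ n)⁻¹ - 1 ≤ gamma u n := by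
  have hpos : 0 < 1 - (n : K) * u := by linarith
  have hb := one_sub_mul_le_one_sub_pow hu1.le n
  have h1 : ((1 - u) ^ n)⁻¹ ≤ (1 - (n : K) * u)⁻¹ := by
    apply inv_anti₀ hpos hb
  linarith [one_add_gamma (u := u) hn]

/-- HIGHAM LEMMA 3.1, product form: if every factor satisfies `1 - u ≤ f_i ≤ (1 - u)⁻¹` (which holds
for `f_i = 1 + δ_i` and for `f_i = (1 + δ_i)⁻¹` whenever `|δ_i| ≤ u < 1`) and `nu < 1`, then
`|∏ f_i - 1| ≤ γ_n`. [cite: Higham2002ASNA, Lemma 3.1] -/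
theorem abs_prod_sub_one_le_gamma {u : K} (hu : 0 ≤ u) (hu1 : u < 1) {n : ℕ}
    (hn : (n : K) * u < 1) (f : Fin n → K) (hlo : ∀ i, 1 - u ≤ f i)
    (hhi : ∀ i, f i ≤ (1 - u)⁻¹) : |∏ i, f i - 1| ≤ gamma u n := by
  have h1u : 0 < 1 - u := by linarith
  have hf0 : ∀ i, 0 ≤ f i := fun i => le_trans h1u.le (hlo i)
  -- upper bound
  have hup : ∏ i, f i ≤ ((1 - u) ^ n)⁻¹ := by
    calc ∏ i, f i ≤ ∏ _i : Fin n, (1 - u)⁻¹ :=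
          Finset.prod_le_prod (fun i _ => hf0 i) (fun i _ => hhi i)
      _ = ((1 - u) ^ n)⁻¹ := by rw [Finset.prod_const, Finset.card_univ, Fintype.card_fin, inv_pow]
  -- lower bound
  have hlow : (1 - u) ^ n ≤ ∏ i, f i := by
    calc (1 - u) ^ n = ∏ _i : Fin n, (1 - u) := by
          rw [Finset.prod_const, Finset.card_univ, Fintype.card_fin]
      _ ≤ ∏ i, f i := Finset.prod_le_prod (fun i _ => h1u.le) (fun i _ => hlo i)
  have hb := one_sub_mul_le_one_sub_pow hu1.le n
  have hg := mul_le_gamma hu hn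
  have hinv := inv_one_sub_pow_sub_one_le_gamma hu1 hn
  rw [abs_le]
  constructor <;> linarith

/-- HIGHAM LEMMA 3.1, `δ/ρ` form: if `|δ_i| ≤ u < 1`, `ρ_i ∈ {1, -1}` and `nu < 1` then
`∏ (1 + δ_i)^{ρ_i} = 1 + θ` with `|θ| ≤ γ_n`. [cite: Higham2002ASNA, Lemma 3.1] -/
theorem exists_theta_prod_eq {u : K} (hu : 0 ≤ u) (hu1 : u < 1) {n : ℕ} (hn : (n : K) * u < 1)
    (δ : Fin n → K) (ρ : Fin n → ℤ) (hδ : ∀ i, |δ i| ≤ u) (hρ : ∀ i, ρ i = 1 ∨ ρ i = -1) :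
    ∃ θ : K, ∏ i, (1 + δ i) ^ (ρ i) = 1 + θ ∧ |θ| ≤ gamma u n := by
  refine ⟨∏ i, (1 + δ i) ^ (ρ i) - 1, by ring, ?_⟩
  have h1u : 0 < 1 - u := by linarith
  apply abs_prod_sub_one_le_gamma hu hu1 hn
  · intro i
    have hd := abs_le.mp (hδ i)
    rcases hρ i with h | h <;> rw [h]
    · rw [zpow_one]; linarith
    · rw [zpow_neg_one]
      -- 1 - u ≤ (1 + δ)⁻¹ since (1 + δ)(1 - u) ≤ (1 + u)(1 - u) ≤ 1
      have hpos : 0 < 1 + δ i := by linarith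
      rw [inv_eq_one_div, le_div_iff₀ hpos]
      nlinarith [mul_le_mul_of_nonneg_left hd.2 h1u.le]
  · intro i
    have hd := abs_le.mp (hδ i)
    rcases hρ i with h | h <;> rw [h]
    · rw [zpow_one]
      calc 1 + δ i ≤ 1 + u := by linarith
        _ ≤ (1 - u)⁻¹ := by
            rw [inv_eq_one_div, le_div_iff₀ h1u]
            nlinarith
    · rw [zpow_neg_one]
      have hpos : 0 < 1 + δ i := by linarith
      exact inv_anti₀ h1u (by linarith)

end Literature.ComputerArithmetic.Higham2002
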